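import Summits.AtomisticToContinuum.HydrodynamicLimit.Theses.JParityClosure
import Literature.MathematicalPhysics.KineticTheory.EvenCollisionTubeFunctional
import Literature.MathematicalPhysics.KineticTheory.EvenStatTruncationBound
import Summits.AtomisticToContinuum.HydrodynamicLimit.Theorems.EvenStressEnskog.Negative.ContactValueZero
import HarnessLib

/-!
# Enskog identification (stub S6b of the line `stationary-microscale-hierarchy-entrance-law`,
# crux `JParityClosure.EvenStressEnskog`, stmt-AtomisticToContinuum-13079) — helper 1:
# the clamped contact value, the density weight and the second-moment test function

Elementary ingredients of the identification step `contactPredM − σ³∫ enskogRate =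
−(oneBodyStat − oneBodyPred)`:

* `exists_contactValue_clamp` — by the low-density equation of state (`hsEosLowDensity_proof`:
  `f_ex = F` on `[0, η_Y)`, `F` analytic on `(−η_Y, η_Y)`) there is a CONTINUOUS `Ỹ : ℝ → ℝ` with
  `Ỹ = Y := contactValue` on `(0, η_Y/2]` (`Ỹ a = (3/2π) F′(clamp a)`, the clamp into `[0, η_Y/2]`);
  no continuity of `Y` itself at `0` is claimed (there `Y 0 = 0` is `deriv`-junk).
* `weight_continuous`, `weight_eq_zero_of_le`, `mul_contactValue_mul_eq_weight`,
  `exists_bound_weight`, `exists_bound_mul_contactValue_of_clamp` — the density weight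
  `k(a) = g(a) Ỹ(a) a` of a continuous cutoff `g` vanishing on `[η₀, ∞)`, `η₀ ≤ η_Y/2`: continuous,
  vanishing where `g` does, `g(a) Y(a) a = k(a)` for EVERY `a ≥ 0`, and `|k|`, `|g·Y|` bounded on `[0, ∞)`.
* `continuous_secondMomentTest`, `abs_secondMomentTest_le`, `abs_secondMomentTest_le_quad` — the
  test function `F_{kl}(v, u, θ) = ∫_{S²} ⟪v − u, ω⟫² ω_k ω_l dσ(ω)` (written out, no definition) is
  continuous with `|F_{kl}(v,u,θ)| ≤ |S²| ‖v − u‖² ≤ 2|S²| (1 + ‖v‖² + ‖u‖² + |θ|)`.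

The file ends with the registered Tools sub-stub `stub_enskogIdentificationWeightTools` (clamp existence,
continuity and the quadratic bound of `F_{kl}`), so that it rides with `stub_enskogIdentification_of_pointwise`.

References: Chapman–Cowling (1970) Ch. 16 (the contact value `Y` in Enskog's collision term);
Ruelle (1969) §3.4 (analyticity of the low-density equation of state).
-/

noncomputable section

open scoped BigOperators InnerProductSpace Topology ENNReal
open MeasureTheory Filter Set
open Literature.MathematicalPhysics.KineticTheory Literature.Analysis.FluidPDE

namespace Summit.AtomisticToContinuum.HydrodynamicLimit.Theorems.EvenStressEnskog

/-! ## The clamped contact value -/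

/-- **The contact value agrees with a continuous function on a low-density band.**  There are
`η_Y > 0` and a continuous `Ỹ : ℝ → ℝ` with `Ỹ a = Y a = contactValue a` for `0 < a ≤ η_Y`:
from `hsEosLowDensity_proof` (`f_ex = F` on `[0, η₁)`, `F` analytic on `(−η₁, η₁)`), `η_Y := η₁/2` and
`Ỹ a := (3/2π) F′(max (min a η_Y) 0)`; on the OPEN band `deriv f_ex = F′`
(`Filter.EventuallyEq.deriv_eq`). [folklore] -/
theorem exists_contactValue_clamp :
    ∃ ηY : ℝ, 0 < ηY ∧ ∃ Yt : ℝ → ℝ, Continuous Yt ∧ ∀ a, 0 < a → a ≤ ηY → Yt a = contactValue a := by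
  obtain ⟨η₁, hη₁, F, hF, hEq, -, -, -⟩ := hsEosLowDensity_proof
  refine ⟨η₁ / 2, by positivity, fun a => 3 / (2 * Real.pi) * deriv F (max (min a (η₁ / 2)) 0), ?_, ?_⟩
  · have hcl : Continuous fun a : ℝ => max (min a (η₁ / 2)) 0 := by fun_prop
    have hmem : ∀ a : ℝ, max (min a (η₁ / 2)) 0 ∈ Ioo (-η₁) η₁ := fun a =>
      ⟨lt_of_lt_of_le (by linarith) (le_max_right _ _),
        lt_of_le_of_lt (max_le (min_le_right _ _) (by positivity)) (by linarith)⟩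
    exact continuous_const.mul (hF.deriv.continuousOn.comp_continuous hcl hmem)
  · intro a ha haY
    have hcl : max (min a (η₁ / 2)) 0 = a := by
      rw [min_eq_left haY, max_eq_left ha.le]
    have hnhds : hsExcessFreeEnergy =ᶠ[𝓝 a] F :=
      Filter.eventuallyEq_of_mem (isOpen_Ioo.mem_nhds ⟨ha, by linarith⟩)
        (hEq.mono (Ioo_subset_Ico_self : Ioo 0 η₁ ⊆ Ico 0 η₁))
    simp only [hcl]
    rw [contactValue, hnhds.deriv_eq]

/-! ## The density weight `k(a) = g(a) Ỹ(a) a` -/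

/-- The weight `a ↦ g a · Ỹ a · a` is continuous. [folklore] -/
theorem weight_continuous {g Yt : ℝ → ℝ} (hg : Continuous g) (hYt : Continuous Yt) :
    Continuous fun a => g a * Yt a * a :=
  (hg.mul hYt).mul continuous_id

/-- The weight vanishes wherever the cutoff does: `g = 0` on `[η₁, ∞)` gives `k = 0` there. [folklore] -/
theorem weight_eq_zero_of_le {g Yt : ℝ → ℝ} {η₁ : ℝ} (hg0 : ∀ a, η₁ ≤ a → g a = 0) :
    ∀ a, η₁ ≤ a → g a * Yt a * a = 0 := fun a ha => by
  rw [hg0 a ha, zero_mul, zero_mul]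

/-- **The junk-robust identity `g(a) Y(a) a = g(a) Ỹ(a) a` for every `a ≥ 0`**, when `Ỹ = Y` on
`(0, η_Y]` and `g` vanishes on `[η₀, ∞)` with `η₀ ≤ η_Y`: at `a = 0` by the factor `a`, on `(0, η_Y]`
by `Ỹ = Y`, above `η_Y ≥ η₀` by `g = 0`. [folklore] -/
theorem mul_contactValue_mul_eq_weight {g Yt : ℝ → ℝ} {η₀ ηY : ℝ}
    (hYeq : ∀ a, 0 < a → a ≤ ηY → Yt a = contactValue a) (hle : η₀ ≤ ηY)
    (hg0 : ∀ a, η₀ ≤ a → g a = 0) {a : ℝ} (ha : 0 ≤ a) :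
    g a * contactValue a * a = g a * Yt a * a := by
  rcases ha.eq_or_lt with h0 | hpos
  · rw [← h0, mul_zero, mul_zero]
  by_cases hY : a ≤ ηY
  · rw [hYeq a hpos hY]
  · push Not at hY
    rw [hg0 a (hle.trans hY.le), zero_mul, zero_mul, zero_mul, zero_mul]

/-- A continuous function vanishing on `[η₁, ∞)` (`0 < η₁`) is bounded on `[0, ∞)`. [folklore] -/
theorem exists_bound_of_eq_zero_of_le {k : ℝ → ℝ} (hk : Continuous k) {η₁ : ℝ} (hη₁ : 0 < η₁)
    (hk0 : ∀ a, η₁ ≤ a → k a = 0) : ∃ C : ℝ, 0 ≤ C ∧ ∀ a, 0 ≤ a → |k a| ≤ C := by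
  obtain ⟨C, hC⟩ := (isCompact_Icc (a := (0 : ℝ)) (b := η₁)).exists_bound_of_continuousOn hk.continuousOn
  refine ⟨C, (norm_nonneg _).trans (hC 0 ⟨le_rfl, hη₁.le⟩), fun a ha => ?_⟩
  by_cases h : a ≤ η₁
  · simpa only [Real.norm_eq_abs] using hC a ⟨ha, h⟩
  · push Not at h
    rw [hk0 a h.le, abs_zero]
    exact (norm_nonneg _).trans (hC 0 ⟨le_rfl, hη₁.le⟩)

/-- **`g · Y` is bounded on `[0, ∞)`** for a continuous cutoff `g` vanishing on `[η₀, ∞)`,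
`0 < η₀ ≤ η_Y`: `g a Y a = g a Ỹ a` for `a > 0` (as in `mul_contactValue_mul_eq_weight`), `Y 0 = 0`
(`contactValue_zero`), and `g Ỹ` is continuous and vanishes on `[η₀, ∞)`. [folklore] -/
theorem exists_bound_mul_contactValue_of_clamp {g Yt : ℝ → ℝ} {η₀ ηY : ℝ} (hg : Continuous g)
    (hYt : Continuous Yt) (hYeq : ∀ a, 0 < a → a ≤ ηY → Yt a = contactValue a) (hη₀ : 0 < η₀)
    (hle : η₀ ≤ ηY) (hg0 : ∀ a, η₀ ≤ a → g a = 0) :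
    ∃ C : ℝ, 0 ≤ C ∧ ∀ a, 0 ≤ a → |g a * contactValue a| ≤ C := by
  obtain ⟨C, hC0, hC⟩ := exists_bound_of_eq_zero_of_le (hg.mul hYt) hη₀
    (fun a ha => by rw [Pi.mul_apply, hg0 a ha, zero_mul])
  refine ⟨C, hC0, fun a ha => ?_⟩
  rcases ha.eq_or_lt with h0 | hpos
  · rw [← h0, contactValue, contactValue_zero, mul_zero, abs_zero]
    exact hC0
  by_cases hY : a ≤ ηY
  · rw [← hYeq a hpos hY]
    exact hC a ha
  · push Not at hY
    rw [hg0 a (hle.trans hY.le), zero_mul, abs_zero]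
    exact hC0

/-! ## The second-moment test function `F_{kl}(v, u, θ) = ∫_{S²} ⟪v − u, ω⟫² ω_k ω_l dσ(ω)` -/

/-- The integrand of `F_{kl}` is bounded by `‖v − u‖²` on the unit sphere. [folklore] -/
theorem abs_inner_sq_mul_coord_le (k l : Fin 3) (a : V3) (ω : Metric.sphere (0 : V3) 1) :
    |⟪a, (ω : V3)⟫_ℝ ^ 2 * ((ω : V3) k * (ω : V3) l)| ≤ ‖a‖ ^ 2 := by
  have hω : ‖(ω : V3)‖ = 1 := norm_coe_unitSphere ω
  have h1 : |⟪a, (ω : V3)⟫_ℝ| ≤ ‖a‖ := by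
    calc |⟪a, (ω : V3)⟫_ℝ| ≤ ‖a‖ * ‖(ω : V3)‖ := abs_real_inner_le_norm _ _
      _ = ‖a‖ := by rw [hω, mul_one]
  have hk : |(ω : V3) k| ≤ 1 := by
    have := PiLp.norm_apply_le (ω : V3) k
    rwa [hω, Real.norm_eq_abs] at this
  have hl : |(ω : V3) l| ≤ 1 := by
    have := PiLp.norm_apply_le (ω : V3) l
    rwa [hω, Real.norm_eq_abs] at this
  rw [abs_mul, abs_mul, abs_pow]
  calc |⟪a, (ω : V3)⟫_ℝ| ^ 2 * (|(ω : V3) k| * |(ω : V3) l|) ≤ ‖a‖ ^ 2 * (1 * 1) :=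
        mul_le_mul (pow_le_pow_left₀ (abs_nonneg _) h1 2)
          (mul_le_mul hk hl (abs_nonneg _) zero_le_one) (by positivity) (by positivity)
    _ = ‖a‖ ^ 2 := by ring

/-- **`|F_{kl}(v, u, θ)| ≤ |S²| ‖v − u‖²`.** [folklore] -/
theorem abs_secondMomentTest_le (k l : Fin 3) (v u : V3) :
    |∫ ω : Metric.sphere (0 : V3) 1, ⟪v - u, (ω : V3)⟫_ℝ ^ 2 * ((ω : V3) k * (ω : V3) l) ∂sphereMeasure|
      ≤ sphereMeasure.real (univ : Set (Metric.sphere (0 : V3) 1)) * ‖v - u‖ ^ 2 := by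
  haveI := isFiniteMeasure_sphereMeasure_V3
  have h := norm_integral_le_of_norm_le_const (μ := sphereMeasure)
    (f := fun ω : Metric.sphere (0 : V3) 1 => ⟪v - u, (ω : V3)⟫_ℝ ^ 2 * ((ω : V3) k * (ω : V3) l))
    (ae_of_all _ fun ω => by rw [Real.norm_eq_abs]; exact abs_inner_sq_mul_coord_le k l (v - u) ω)
  rw [Real.norm_eq_abs, mul_comm] at h
  exact h

/-- **Second-moment growth of `F_{kl}`**: `|F_{kl}(v,u,θ)| ≤ 2|S²| (1 + ‖v‖² + ‖u‖² + |θ|)`, the growth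
class of the one-body statement (L1). [folklore] -/
theorem abs_secondMomentTest_le_quad (k l : Fin 3) (q : V3 × V3 × ℝ) :
    |∫ ω : Metric.sphere (0 : V3) 1, ⟪q.1 - q.2.1, (ω : V3)⟫_ℝ ^ 2 * ((ω : V3) k * (ω : V3) l) ∂sphereMeasure|
      ≤ 2 * sphereMeasure.real (univ : Set (Metric.sphere (0 : V3) 1)) *
        (1 + ‖q.1‖ ^ 2 + ‖q.2.1‖ ^ 2 + |q.2.2|) := by
  have hS0 : 0 ≤ sphereMeasure.real (univ : Set (Metric.sphere (0 : V3) 1)) := measureReal_nonneg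
  have h1 := abs_secondMomentTest_le k l q.1 q.2.1
  have h2 : ‖q.1 - q.2.1‖ ^ 2 ≤ 2 * (1 + ‖q.1‖ ^ 2 + ‖q.2.1‖ ^ 2 + |q.2.2|) := by
    have h' : ‖q.1 - q.2.1‖ ^ 2 ≤ (‖q.1‖ + ‖q.2.1‖) ^ 2 :=
      pow_le_pow_left₀ (norm_nonneg _) (norm_sub_le _ _) 2
    nlinarith [sq_nonneg (‖q.1‖ - ‖q.2.1‖), abs_nonneg q.2.2]
  nlinarith [mul_le_mul_of_nonneg_left h2 hS0]

/-- **`F_{kl}` is continuous** on `V3 × V3 × ℝ` (parametric integral of a jointly continuous integrand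
over the compact unit sphere). [folklore] -/
theorem continuous_secondMomentTest (k l : Fin 3) :
    Continuous fun q : V3 × V3 × ℝ =>
      ∫ ω : Metric.sphere (0 : V3) 1, ⟪q.1 - q.2.1, (ω : V3)⟫_ℝ ^ 2 * ((ω : V3) k * (ω : V3) l) ∂sphereMeasure := by
  haveI := isFiniteMeasure_sphereMeasure_V3
  have hf : Continuous (Function.uncurry fun (q : V3 × V3 × ℝ) (ω : Metric.sphere (0 : V3) 1) =>
      ⟪q.1 - q.2.1, (ω : V3)⟫_ℝ ^ 2 * ((ω : V3) k * (ω : V3) l)) := by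
    unfold Function.uncurry
    fun_prop
  have h := continuous_parametric_integral_of_continuous (μ := sphereMeasure) hf isCompact_univ
  simp only [Measure.restrict_univ] at h
  exact h

/-- `F_{kl}` has the second-moment growth witness consumed by (L1). [folklore] -/
theorem exists_abs_secondMomentTest_le (k l : Fin 3) :
    ∃ C : ℝ, ∀ q : V3 × V3 × ℝ,
      |(fun q : V3 × V3 × ℝ => ∫ ω : Metric.sphere (0 : V3) 1,
          ⟪q.1 - q.2.1, (ω : V3)⟫_ℝ ^ 2 * ((ω : V3) k * (ω : V3) l) ∂sphereMeasure) q|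
        ≤ C * (1 + ‖q.1‖ ^ 2 + ‖q.2.1‖ ^ 2 + |q.2.2|) :=
  ⟨2 * sphereMeasure.real (univ : Set (Metric.sphere (0 : V3) 1)), abs_secondMomentTest_le_quad k l⟩


/-! ## Registered Tools sub-stub -/

/-- **Tools sub-stub of the Enskog identification (S6b), weight part** — registered on the crux item so that
this helper file rides with `stub_enskogIdentification_of_pointwise`: the continuous clamp of the contact
value on a low-density band, and continuity and the quadratic bound of the second-moment test function
`F_{kl}`. [folklore] -/
theorem stub_enskogIdentificationWeightTools :
    (∃ ηY : ℝ, 0 < ηY ∧ ∃ Yt : ℝ → ℝ, Continuous Yt ∧ ∀ a, 0 < a → a ≤ ηY → Yt a = contactValue a) ∧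
    (∀ k l : Fin 3, Continuous fun q : V3 × V3 × ℝ =>
      ∫ ω : Metric.sphere (0 : V3) 1, ⟪q.1 - q.2.1, (ω : V3)⟫_ℝ ^ 2 * ((ω : V3) k * (ω : V3) l) ∂sphereMeasure) ∧
    (∀ (k l : Fin 3) (v u : V3),
      |∫ ω : Metric.sphere (0 : V3) 1, ⟪v - u, (ω : V3)⟫_ℝ ^ 2 * ((ω : V3) k * (ω : V3) l) ∂sphereMeasure|
        ≤ sphereMeasure.real (Set.univ : Set (Metric.sphere (0 : V3) 1)) * ‖v - u‖ ^ 2) :=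
  ⟨exists_contactValue_clamp, continuous_secondMomentTest, abs_secondMomentTest_le⟩

end Summit.AtomisticToContinuum.HydrodynamicLimit.Theorems.EvenStressEnskog

end
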